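import Summits.BirchSwinnertonDyer.BirchSwinnertonDyer.Theorems.PrintX8VSInputHondaSystemSprungLogValues
import Summits.BirchSwinnertonDyer.BirchSwinnertonDyer.Theorems.PrintX8VSInputHondaSystemSprungHondaIso
import Summits.BirchSwinnertonDyer.Rank1Residual.Additive.KobayashiTowerPoints
import HarnessLib

/-!
# Sprung's tower points `c_m ∈ E₁(ℚ_p(ζ_{p^m}))` inside `E(ℚ̄_p)`: the values
# `Λ(c_m) = ℓ_m = ∑_{k<m} x_k (ζ_{p^{m−k}} − 1)` and the TRACE IDENTITY
# `∑_{Gal(k_m/k_{m−1})} σℓ_{m+1} = −p + a ℓ_m − ℓ_{m−1}` (route `PrintX8VS` / `PrintX8`, support item `InputHondaSystem` =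
# stmt-BirchSwinnertonDyer-20413, named fact `Sprung2012.thm22_exists_isHondaSystem`; file 4 of the local series — the
# general-`a_p` twin of §§1–2 of the tree's `Rank1Residual/Additive/KobayashiTowerPoints`, whose §3 (Galois behaviour of `Λ`)
# is reused as is)

HONEST FRAMING (desk `pub/bsd-wall/bsd-inputs`, seat `bsd-inputs-honda-p1`, D-0154 (2) INPUTS): THEOREMS ONLY — no definition, no
named fact, no instance, no `sorry`; closes nothing by itself; BSD is not proved by any of this.

## Setting (`Ω = PadicAlgCl p`, `ζ_j = zeta p j`, `E_Ω = genFibΩ p M`, `L(m)` = points with coordinates in `layer p m = ℚ_p(ζ_m)`,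
## `E₁ = kernel`, `Λ = ptLogΩ`; the Sprung sequence `x` with `x 0 = 1`, `p x 1 = a`, `p x (k+2) = a x (k+1) − x k`)

To stay DEFINITION-FREE, `ℓ_m` is the explicit sum `∑_{k<m} x_k (ζ_{m−k} − 1)` (`x_k` read in `Ω` through `algebraMap`), and the
points are delivered EXISTENTIALLY: `exists_sprungTowerPoints` produces `c : ℕ → E_Ω` with `c 0 = O`, `c m ∈ L(m) ∩ E₁` and
`Λ(c m) = ℓ_m` (the Honda point of `ζ_m − 1` in the complete layer `LayerField p m`, embedded by `toOmega`, for the integral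
Honda isomorphism `i` of file 3). Sprung 2012, proof of Thm. 2.2 (p. 1487): "Addition in our formal group then allows us to
construct `c_n = ε [+]_{F_ss} (ζ_{p^N} − 1)`" — here WITHOUT the `ε`-shift (added at the `ℤ_p`-layer stage), exactly as
Kobayashi's `c_n` of the tree's `KobayashiTowerPoints` (`a_p = 0`: `ℓ_m = ∑_{k<m}(−1)ᵏ(ζ_{m−2k} − 1)/pᵏ`).

* §1 `ζ_m^{pᵏ} = ζ_{m−k}`; `ℓ_0 = 0`; `ℓ_{m+1} = (ζ_{m+1} − 1) + (tail in layer m)`; **the trace identity**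
  `∑_{q ∈ stab m/stab (m+1)} q̃ • ℓ_{m+1} = −p + a·ℓ_m − ℓ_{m−1}` for `m ≥ 1` (the recursion `p x_{k+1} = a x_k − x_{k−1}` against
  `Tr(ζ_{m+1}) = 0`, i.e. `∑ q̃•(ζ_{m+1} − 1) = −p`), and `= −p` at `m = 0`; `ℓ_m − (ζ_m − 1) ∈ layer (m−1)`.
* §2 **`exists_sprungTowerPoints`**: the points `c_m` with `Λ(c_m) = ℓ_m` (finite form of `log_{F_ss}` at `ζ_m − 1`, file 2, and
  `Λ(P(i(y))) = log_{F_ss}(y)`, file 3).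

References: [Sprung2012] F. Sprung, J. Number Theory 132 (2012), Thm. 2.2 and its proof (p. 1487); [Kobayashi2003] S. Kobayashi,
Invent. Math. 152 (2003), §8.4, Def. 8.8, Lemma 8.9.
-/

set_option autoImplicit false
-- the Theorems namespace of this sub repeats the summit name by design (D-0017 nested layout)
set_option linter.dupNamespace false

noncomputable section

open scoped Classical Topology NNReal
open Filter PowerSeries Finset

namespace Summit.BirchSwinnertonDyer.BirchSwinnertonDyer.Theorems

namespace SprungHonda

open Summit.BirchSwinnertonDyer.Rank1Residual.Additive Summit.BirchSwinnertonDyer.Rank1Residual.Additive.BallEval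
open Summit.BirchSwinnertonDyer.Rank1Residual.Additive.PadicCyclotomicTower
open Literature.NumberTheory.GaloisRepresentations.LubinTate (unitBall)
open Literature.NumberTheory.EllipticCurves.FormalGroupChart (kernel)

variable {p : ℕ} [hp : Fact p.Prime]

/-! ## §1 The logarithms `ℓ_m = ∑_{k<m} x_k(ζ_{m−k} − 1)` and their traces -/

/-- `ζ_m^{pᵏ} = ζ_{m−k}` (with `ζ_0 = 1` when `k ≥ m`). [folklore] -/
theorem zeta_pow_prime_pow (m k : ℕ) : zeta p m ^ p ^ k = zeta p (m - k) := by
  by_cases h : k ≤ m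
  · obtain ⟨j, rfl⟩ := Nat.exists_eq_add_of_le' h
    rw [Nat.add_sub_cancel, zeta_add_pow]
  · push Not at h
    rw [Nat.sub_eq_zero_of_le h.le, zeta_zero, zeta_pow_eq_one_of_le p h.le]

/-- `ℓ_0 = 0` (empty sum). [folklore] -/
theorem sprungEll_zero (x : ℕ → ℚ_[p]) :
    ∑ k ∈ range 0, algebraMap ℚ_[p] (PadicAlgCl p) (x k) * (zeta p (0 - k) - 1) = 0 := by
  rw [sum_range_zero]

/-- `ℓ_{m+1} = x_0 (ζ_{m+1} − 1) + ∑_{k<m} x_{k+1}(ζ_{m−k} − 1)`. [folklore] -/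
theorem sprungEll_succ (x : ℕ → ℚ_[p]) (m : ℕ) :
    ∑ k ∈ range (m + 1), algebraMap ℚ_[p] (PadicAlgCl p) (x k) * (zeta p (m + 1 - k) - 1) =
      algebraMap ℚ_[p] (PadicAlgCl p) (x 0) * (zeta p (m + 1) - 1) +
        ∑ k ∈ range m, algebraMap ℚ_[p] (PadicAlgCl p) (x (k + 1)) * (zeta p (m - k) - 1) := by
  rw [sum_range_succ', Nat.sub_zero, add_comm]
  congr 1
  exact sum_congr rfl fun k _ ↦ by rw [show m + 1 - (k + 1) = m - k by omega]

/-- The terms `x_{k+1}(ζ_{m−k} − 1)` lie in `layer m` and are fixed by `stab p m`. [folklore] -/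
theorem smul_sprungEll_tail_term (x : ℕ → ℚ_[p]) {m : ℕ} (k : ℕ) {σ : Field.absoluteGaloisGroup ℚ_[p]}
    (hσ : σ ∈ stab p m) :
    σ • (algebraMap ℚ_[p] (PadicAlgCl p) (x (k + 1)) * (zeta p (m - k) - 1)) =
      algebraMap ℚ_[p] (PadicAlgCl p) (x (k + 1)) * (zeta p (m - k) - 1) := by
  refine smul_eq_self_of_mem_stab hσ ?_
  have hz : zeta p (m - k) ∈ layer p m := layer_mono p (Nat.sub_le m k) (zeta_mem_layer p (m - k))
  exact mul_mem ((layer p m).algebraMap_mem _) (sub_mem hz (one_mem _))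

/-- `p · ∑_{k<m} x_{k+1}(ζ_{m−k} − 1) = a ℓ_m − ℓ_{m−1}` for `m ≥ 1`: the recursion `p x_1 = a x_0` (`x_0 = 1`),
`p x_{k+2} = a x_{k+1} − x_k`, term by term. [cite: Sprung2012, Def. 2.1 and proof of Thm. 2.2 (p. 1487)] -/
theorem p_mul_sprungEll_tail {a : ℤ} {x : ℕ → ℚ_[p]} (hx0 : x 0 = 1) (hx1 : (p : ℚ_[p]) * x 1 = a)
    (hrec : ∀ k, (p : ℚ_[p]) * x (k + 2) = a * x (k + 1) - x k) {m : ℕ} (hm : 1 ≤ m) :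
    (p : PadicAlgCl p) * ∑ k ∈ range m, algebraMap ℚ_[p] (PadicAlgCl p) (x (k + 1)) * (zeta p (m - k) - 1) =
      (a : PadicAlgCl p) * ∑ k ∈ range m, algebraMap ℚ_[p] (PadicAlgCl p) (x k) * (zeta p (m - k) - 1) -
        ∑ k ∈ range (m - 1), algebraMap ℚ_[p] (PadicAlgCl p) (x k) * (zeta p (m - 1 - k) - 1) := by
  obtain ⟨m', rfl⟩ := Nat.exists_eq_add_of_le' hm
  rw [Nat.add_sub_cancel]
  -- images of the recursion in `Ω`
  set X : ℕ → PadicAlgCl p := fun k ↦ algebraMap ℚ_[p] (PadicAlgCl p) (x k) with hX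
  have hX0 : X 0 = 1 := by simp [hX, hx0]
  have hX1 : (p : PadicAlgCl p) * X 1 = a := by
    have h := congrArg (algebraMap ℚ_[p] (PadicAlgCl p)) hx1
    rwa [map_mul, map_natCast, map_intCast] at h
  have hXr : ∀ k, (p : PadicAlgCl p) * X (k + 2) = a * X (k + 1) - X k := fun k ↦ by
    have h := congrArg (algebraMap ℚ_[p] (PadicAlgCl p)) (hrec k)
    rwa [map_mul, map_sub, map_mul, map_natCast, map_intCast] at h
  change (p : PadicAlgCl p) * ∑ k ∈ range (m' + 1), X (k + 1) * (zeta p (m' + 1 - k) - 1) =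
    (a : PadicAlgCl p) * ∑ k ∈ range (m' + 1), X k * (zeta p (m' + 1 - k) - 1) -
      ∑ k ∈ range m', X k * (zeta p (m' - k) - 1)
  rw [sum_range_succ' (fun k ↦ X (k + 1) * (zeta p (m' + 1 - k) - 1)),
    sum_range_succ' (fun k ↦ X k * (zeta p (m' + 1 - k) - 1)), Nat.sub_zero, hX0, one_mul, mul_add, mul_add,
    mul_sum, mul_sum, ← mul_assoc, hX1]
  have hterm : ∀ k ∈ range m', (p : PadicAlgCl p) * (X (k + 1 + 1) * (zeta p (m' + 1 - (k + 1)) - 1)) =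
      (a : PadicAlgCl p) * (X (k + 1) * (zeta p (m' + 1 - (k + 1)) - 1)) - X k * (zeta p (m' - k) - 1) := by
    intro k _
    rw [show m' + 1 - (k + 1) = m' - k by omega, ← mul_assoc, hXr k]; ring
  rw [sum_congr rfl hterm, sum_sub_distrib]
  ring

/-- **The trace identity** for `m ≥ 1`: `∑_{q ∈ stab m / stab (m+1)} q̃ • ℓ_{m+1} = −p + a ℓ_m − ℓ_{m−1}`
(`∑ q̃ • (ζ_{m+1} − 1) = −p`, the other terms of `ℓ_{m+1}` are fixed and counted `p` times). [cite: Sprung2012, Thm. 2.2 (1)]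
[cite: Kobayashi2003, Lemma 8.9] -/
theorem sum_smul_sprungEll_succ {a : ℤ} {x : ℕ → ℚ_[p]} (hx0 : x 0 = 1) (hx1 : (p : ℚ_[p]) * x 1 = a)
    (hrec : ∀ k, (p : ℚ_[p]) * x (k + 2) = a * x (k + 1) - x k) {m : ℕ} (hm : 1 ≤ m)
    [Fintype (stab p m ⧸ (stab p (m + 1)).subgroupOf (stab p m))] :
    ∑ q : stab p m ⧸ (stab p (m + 1)).subgroupOf (stab p m), ((q.out : stab p m) : Field.absoluteGaloisGroup ℚ_[p]) •
        ∑ k ∈ range (m + 1), algebraMap ℚ_[p] (PadicAlgCl p) (x k) * (zeta p (m + 1 - k) - 1) =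
      -(p : PadicAlgCl p) + (a : PadicAlgCl p) * ∑ k ∈ range m, algebraMap ℚ_[p] (PadicAlgCl p) (x k) * (zeta p (m - k) - 1) -
        ∑ k ∈ range (m - 1), algebraMap ℚ_[p] (PadicAlgCl p) (x k) * (zeta p (m - 1 - k) - 1) := by
  simp_rw [sprungEll_succ, hx0, map_one, one_mul, smul_add, smul_sum]
  rw [sum_add_distrib, sum_out_smul_zeta_succ_sub_one, sum_comm]
  have hfix : ∀ k ∈ range m, ∑ q : stab p m ⧸ (stab p (m + 1)).subgroupOf (stab p m),
      ((q.out : stab p m) : Field.absoluteGaloisGroup ℚ_[p]) •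
        (algebraMap ℚ_[p] (PadicAlgCl p) (x (k + 1)) * (zeta p (m - k) - 1)) =
      (p : PadicAlgCl p) * (algebraMap ℚ_[p] (PadicAlgCl p) (x (k + 1)) * (zeta p (m - k) - 1)) := by
    intro k _
    rw [sum_out_smul_of_forall_smul_eq m fun σ hσ ↦ smul_sprungEll_tail_term x k hσ,
      index_subgroupOf_stab_succ, if_neg (by omega), nsmul_eq_mul]
  rw [sum_congr rfl hfix, ← mul_sum, p_mul_sprungEll_tail hx0 hx1 hrec hm]
  ring

/-- **The trace identity at the bottom**: `∑_{q ∈ Γ / stab 1} q̃ • ℓ_1 = −p` (`ℓ_1 = ζ_1 − 1`). [cite: Sprung2012, Thm. 2.2 (2)]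
[cite: Kobayashi2003, Lemma 8.9] -/
theorem sum_smul_sprungEll_one {x : ℕ → ℚ_[p]} (hx0 : x 0 = 1) [Fintype (stab p 0 ⧸ (stab p 1).subgroupOf (stab p 0))] :
    ∑ q : stab p 0 ⧸ (stab p 1).subgroupOf (stab p 0), ((q.out : stab p 0) : Field.absoluteGaloisGroup ℚ_[p]) •
        ∑ k ∈ range 1, algebraMap ℚ_[p] (PadicAlgCl p) (x k) * (zeta p (1 - k) - 1) = -(p : PadicAlgCl p) := by
  simp_rw [sum_range_one, Nat.sub_zero, hx0, map_one, one_mul]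
  exact sum_out_smul_zeta_succ_sub_one p 0

/-- The tail of `ℓ_m` lies in `layer (m−1)`: **`ℓ_m − (ζ_m − 1) ∈ layer (m − 1)`** (`m ≥ 1`, `x_0 = 1`). [folklore] -/
theorem sprungEll_sub_mem_layer_pred {x : ℕ → ℚ_[p]} (hx0 : x 0 = 1) {m : ℕ} (hm : 1 ≤ m) :
    ∑ k ∈ range m, algebraMap ℚ_[p] (PadicAlgCl p) (x k) * (zeta p (m - k) - 1) - (zeta p m - 1) ∈ layer p (m - 1) := by
  obtain ⟨m', rfl⟩ := Nat.exists_eq_add_of_le' hm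
  rw [sprungEll_succ, hx0, map_one, one_mul, add_sub_cancel_left, Nat.add_sub_cancel]
  refine Subalgebra.sum_mem _ fun k _ ↦ ?_
  have hz : zeta p (m' - k) ∈ layer p m' := layer_mono p (Nat.sub_le m' k) (zeta_mem_layer p (m' - k))
  exact IntermediateField.mul_mem _ ((layer p m').algebraMap_mem _) (IntermediateField.sub_mem _ hz (IntermediateField.one_mem _))

/-- `ℓ_m ∈ layer m`. [folklore] -/
theorem sprungEll_mem_layer (x : ℕ → ℚ_[p]) (m : ℕ) :
    ∑ k ∈ range m, algebraMap ℚ_[p] (PadicAlgCl p) (x k) * (zeta p (m - k) - 1) ∈ layer p m := by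
  refine Subalgebra.sum_mem _ fun k _ ↦ ?_
  have hz : zeta p (m - k) ∈ layer p m := layer_mono p (Nat.sub_le m k) (zeta_mem_layer p (m - k))
  exact IntermediateField.mul_mem _ ((layer p m).algebraMap_mem _) (IntermediateField.sub_mem _ hz (IntermediateField.one_mem _))

/-! ## §2 The tower points -/

section Points

variable {M : WeierstrassCurve ℤ_[p]} [hE : (M.map PadicInt.Coe.ringHom).IsElliptic]

/-- **Sprung's / Kobayashi's tower points, existentially** (def-free): for the Sprung sequence `x` (growth `‖x k‖ ≤ (√p)ᵏ`) and an
integral Honda isomorphism `i` with `log_E ∘ (i ⊗ ℚ_p) = log_{F_ss}` (file 3), there are points `c_m ∈ E(ℚ̄_p)` with `c_0 = O`,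
**`c_m ∈ L(m) ∩ E₁`** and **`Λ(c_m) = ℓ_m = ∑_{k<m} x_k(ζ_{m−k} − 1)`** — the Honda point of `ζ_m − 1` in the complete layer
`ℚ_p(ζ_m)` (`(1 + (ζ_m − 1))^{pᵏ} = ζ_{m−k}`, `= 1` for `k ≥ m`: the finite form of `log_{F_ss}`, file 2).
[cite: Sprung2012, proof of Thm. 2.2 (p. 1487)] [cite: Kobayashi2003, Def. 8.8 and Lemma 8.9] -/
theorem exists_sprungTowerPoints {x : ℕ → ℚ_[p]} (hxb : ∀ k, ‖x k‖ ≤ Real.sqrt p ^ k) {i : ℤ_[p]⟦X⟧}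
    (hi0 : constantCoeff i = 0)
    (hlog : (M.map (PadicInt.Coe.ringHom (p := p))).formalLog.subst (i.map PadicInt.Coe.ringHom) =
      PowerSeries.mk fun d ↦ ∑' k : ℕ, x k * (((p ^ k).choose d : ℚ_[p]) - if d = 0 then 1 else 0)) :
    haveI := isIntegral_genFib_baseChange p M
    ∃ c : ℕ → (genFibΩ p M).toAffine.Point, c 0 = 0 ∧
      (∀ m, c m ∈ subfieldPoints (genFibΩ p M) (layer p m).toSubfield coeffs_mem_layer) ∧
      (∀ m, c m ∈ kernel (Valued.v (R := PadicAlgCl p)) (genFibΩ p M)) ∧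
      (∀ m, ptLogΩ p M (c m) = ∑ k ∈ range m, algebraMap ℚ_[p] (PadicAlgCl p) (x k) * (zeta p (m - k) - 1)) := by
  haveI := isIntegral_genFib_baseChange p M
  -- the Honda point of `ζ_m − 1` in the complete layer `K_m = LayerField p m`, embedded
  let c : ℕ → (genFibΩ p M).toAffine.Point := fun m ↦
    if hm : 1 ≤ m then toOmega p M m (ptOf p (LayerField p m) M
      (ev₁ p (LayerField p m) (towerParam p m) (hasEval_of_norm_lt_one (norm_towerParam_lt_one hm)) i)
      (norm_ev₁_lt_one_of_constantCoeff hi0 (norm_towerParam_lt_one hm))) else 0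
  have hc_pos : ∀ {m : ℕ} (hm : 1 ≤ m), c m = toOmega p M m (ptOf p (LayerField p m) M
      (ev₁ p (LayerField p m) (towerParam p m) (hasEval_of_norm_lt_one (norm_towerParam_lt_one hm)) i)
      (norm_ev₁_lt_one_of_constantCoeff hi0 (norm_towerParam_lt_one hm))) := fun hm ↦ dif_pos hm
  have hc0 : c 0 = 0 := dif_neg (by omega)
  refine ⟨c, hc0, fun m ↦ ?_, fun m ↦ ?_, fun m ↦ ?_⟩
  · by_cases hm : 1 ≤ m
    · rw [hc_pos hm]; exact toOmega_mem_subfieldPoints _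
    · rw [show m = 0 by omega, hc0]; exact (subfieldPoints _ _ _).zero_mem
  · by_cases hm : 1 ≤ m
    · haveI := isIntegral_curveK p (LayerField p m) M
      rw [hc_pos hm]
      exact (toOmega_mem_kernel_iff _).mpr (ptOf_mem_kernel _)
    · rw [show m = 0 by omega, hc0]; exact (kernel (Valued.v (R := PadicAlgCl p)) (genFibΩ p M)).zero_mem
  · by_cases hm : 1 ≤ m
    · haveI := isIntegral_curveK p (LayerField p m) M
      rw [hc_pos hm, ptLogΩ_toOmega (ptOf_mem_kernel _), ptLog_ptOf_hondaIso hi0 hlog (norm_towerParam_lt_one hm),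
        qEval_sprungLog_eq_sum_of_pow_eq_one (k₀ := m) hxb (norm_towerParam_lt_one hm) ?_]
      · rw [map_sum]
        refine sum_congr rfl fun k _ ↦ ?_
        rw [map_mul, AlgHom.commutes, map_sub, map_pow, map_add, map_one, emb_towerParam, add_sub_cancel,
          zeta_pow_prime_pow]
      · intro k hk
        apply LayerField.emb_injective
        rw [map_pow, map_add, map_one, emb_towerParam, add_sub_cancel, zeta_pow_eq_one_of_le p hk]
    · rw [show m = 0 by omega, hc0, ptLogΩ_zero, sum_range_zero]

end Points

end SprungHonda

end Summit.BirchSwinnertonDyer.BirchSwinnertonDyer.Theorems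

end
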